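import Summits.QuantumFields.BalabanUV.Beta.DeGiorgiStep

/-!
# Beta / TorusInversePowerSums — LEVEL-FREE INVERSE-POWER SUMS ON THE UNIT TORUS BY DYADIC EXPONENTIAL MAJORANTS:
# `Σ_{y : dist(x,y) ≤ D} (dist(x,y) + 1)^{−(d−1)} ≤ C_d·(D + 1)` — the counting input of the dipole row sum of the Green's function
# (chain «LATTICE-GRADIENT-MEMBER», O.2 item (i) at MODEL level; generic torus bookkeeping)

WHAT IS CERTIFIED (kernel, 0 sorry).  On the unit torus `UT N` (sup torus distance, integer valued):
* §1 **`latticeConst_le`** (`K_d(a) ≤ (4d/a)^d` for `0 < a ≤ d`; b04's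
  `B4Sect5Proof.latticeConst`), `torusSum_exp_le` (b04's `B4Sect5Torus.torusSum_le` read on `UT N`);
* §2 **`inv_pow_le_dyadic`** — the pointwise dyadic majorant: for naturals `s ≤ D` and `J = log₂(D+1)`,
  `((s+1)^{d−1})⁻¹ ≤ e²·Σ_{j ≤ J} (2^j)^{−(d−1)}·e^{−s/2^j}` (the term `j = log₂(s+1)` alone dominates);
* §3 **`sum_inv_pow_dist_le`** — for every finite `S` with `dist(x,y) ≤ D` on `S`:
  **`Σ_{y ∈ S} ((dist(x,y) + 1)^{d−1})⁻¹ ≤ C_d·(D+1)`**, `C_d = 2e²(4d)^d` (`Cps`; `d` only) — exchange the sums, bound each exponential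
  row sum by `K_d(2^{−j}) ≤ (4d·2^j)^d`, and sum the geometric series `Σ_{j ≤ J} 2^j < 2(D+1)`.  No shell counting, no fibrewise
  decomposition: the only lattice input is the exponential row sum.
(unit `b2b-balaban-beta-d4-p2`, GEN 11, MODEL crew; claim «LATTICE-GRADIENT-MEMBER» journal l.23681; consumer: `GreenGradientRowSum`.)

HONEST FRAMING: discharging `BetaPertH` makes Bałaban's UV stability UNCONDITIONAL — NOT the continuum limit, NOT the Clay problem.
HONEST DEPENDENCY (verbatim): «continuum YM on T⁴ ⇐ BetaPertH ∧ nine spine estimates (0/9 proved); BetaPertH ⇐ (D1) ∧ (D4) ∧ CAP+tail;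
G-an2-4 gates asym, D1 and NE2/3/4.»  THIS MODULE DISCHARGES NOTHING of `BetaPertH`, asserts NOTHING printed and cites nothing as a fact
(ABSOLUTE RULE): [folklore] finite sums.  No class change on row D4 (critical-path width 0; D4 DISCHARGE NO DATE); NOT BetaPertH, NOT
continuum, NOT Clay, NOT summit progress.
-/

open scoped BigOperators
open Finset

namespace Summit.QuantumFields.BalabanUV.Beta.TorusInversePowerSums

open Literature.MathematicalPhysics.QuantumFieldTheory.Balaban1983to89
open B5TorusCover (UT)

noncomputable section

variable {d : ℕ} {N : Fin d → ℕ} [∀ i, NeZero (N i)]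

/-! ## §1 The exponential row-sum constant -/

omit [∀ i, NeZero (N i)] in
/-- **`K_d(a) ≤ (4d/a)^d` for `0 < a ≤ d`** (`K_d` = b04's `latticeConst d a = (2(1 − e^{−a/d})⁻¹)^d`; the elementary step
`t/2 ≤ 1 − e^{−t}` on `[0,1]` is the tree's `Literature.NumberTheory.LFunctions.PrimeReciprocal.half_le_one_sub_exp_neg`, re-derived inline from
`1 + t ≤ e^t` to keep the import cone inside this cell). [folklore] -/
theorem latticeConst_le {d : ℕ} (hd : 1 ≤ d) {a : ℝ} (ha : 0 < a) (had : a ≤ d) :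
    B4Sect5Proof.latticeConst d a ≤ (4 * d / a) ^ d := by
  unfold B4Sect5Proof.latticeConst
  have hd0 : (0 : ℝ) < d := by exact_mod_cast hd
  have ht0 : 0 ≤ a / d := div_nonneg ha.le hd0.le
  have ht1 : a / d ≤ 1 := by rw [div_le_one hd0]; exact had
  have hlow : a / d / 2 ≤ 1 - Real.exp (-(a / d)) := by
    have h1 : a / d + 1 ≤ Real.exp (a / d) := Real.add_one_le_exp _
    have h2 : Real.exp (-(a / d)) ≤ 1 / (a / d + 1) := by
      rw [Real.exp_neg, one_div]
      exact inv_anti₀ (by linarith) h1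
    have h3 : 1 / (a / d + 1) ≤ 1 - a / d / 2 := by
      rw [div_le_iff₀ (by linarith)]
      nlinarith
    linarith
  have hpos : 0 < a / d / 2 := by positivity
  refine pow_le_pow_left₀ (mul_nonneg (by norm_num) (inv_nonneg.mpr (by linarith))) ?_ d
  calc 2 * (1 - Real.exp (-(a / d)))⁻¹ ≤ 2 * (a / d / 2)⁻¹ :=
        mul_le_mul_of_nonneg_left (inv_anti₀ hpos hlow) (by norm_num)
    _ = 4 * d / a := by field_simp; ring

/-- b04's uniform exponential row sum, read on `UT N`: `Σ_y e^{−a·dist(x,y)} ≤ K_d(a)` for `a > 0`. [folklore] -/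
theorem torusSum_exp_le {a : ℝ} (ha : 0 < a) (x : UT N) :
    ∑ y : UT N, Real.exp (-(a * dist x y)) ≤ B4Sect5Proof.latticeConst d a :=
  B4Sect5Torus.torusSum_le d (UT.one_le N) ha (UT.toSite N x)

/-! ## §2 The pointwise dyadic majorant -/

omit [∀ i, NeZero (N i)] in
/-- **DYADIC MAJORANT**: for naturals `s ≤ D` and `J = log₂(D+1)`,
`((s+1)^{d−1})⁻¹ ≤ e²·Σ_{j < J+1} ((2^j)^{d−1})⁻¹·e^{−s/2^j}` — the single term `j = log₂(s+1)` (`2^j ≤ s+1 < 2^{j+1}`) dominates, since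
then `(s+1)^{−(d−1)} ≤ (2^j)^{−(d−1)}` and `e^{−s/2^j} ≥ e^{−2}`. [folklore] -/
theorem inv_pow_le_dyadic (d : ℕ) {s D : ℕ} (hsD : s ≤ D) :
    (((s : ℝ) + 1) ^ (d - 1))⁻¹ ≤
      Real.exp 2 * ∑ j ∈ Finset.range (Nat.log 2 (D + 1) + 1), (((2 : ℝ) ^ j) ^ (d - 1))⁻¹ * Real.exp (-(s / (2 : ℝ) ^ j)) := by
  set j₀ := Nat.log 2 (s + 1) with hj₀
  have hlow : 2 ^ j₀ ≤ s + 1 := Nat.pow_log_le_self 2 (by omega)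
  have hup : s + 1 < 2 ^ (j₀ + 1) := Nat.lt_pow_succ_log_self (by norm_num) (s + 1)
  have hj₀J : j₀ ∈ Finset.range (Nat.log 2 (D + 1) + 1) := by
    rw [Finset.mem_range]
    exact Nat.lt_succ_of_le (Nat.log_mono_right (by omega))
  have h2j : (0 : ℝ) < (2 : ℝ) ^ j₀ := by positivity
  -- the dominating term
  have hterm : (((s : ℝ) + 1) ^ (d - 1))⁻¹ ≤ Real.exp 2 * ((((2 : ℝ) ^ j₀) ^ (d - 1))⁻¹ * Real.exp (-(s / (2 : ℝ) ^ j₀))) := by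
    have h1 : (((s : ℝ) + 1) ^ (d - 1))⁻¹ ≤ (((2 : ℝ) ^ j₀) ^ (d - 1))⁻¹ := by
      refine inv_anti₀ (by positivity) (pow_le_pow_left₀ h2j.le ?_ _)
      exact_mod_cast hlow
    have h2 : 1 ≤ Real.exp 2 * Real.exp (-(s / (2 : ℝ) ^ j₀)) := by
      rw [← Real.exp_add]
      refine Real.one_le_exp_iff.mpr ?_
      have hs2 : (s : ℝ) / (2 : ℝ) ^ j₀ ≤ 2 := by
        rw [div_le_iff₀ h2j]
        have : ((s + 1 : ℕ) : ℝ) < ((2 ^ (j₀ + 1) : ℕ) : ℝ) := by exact_mod_cast hup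
        push_cast at this
        rw [pow_succ] at this
        linarith
      linarith
    have h0 : 0 ≤ (((2 : ℝ) ^ j₀) ^ (d - 1))⁻¹ := by positivity
    calc (((s : ℝ) + 1) ^ (d - 1))⁻¹ ≤ (((2 : ℝ) ^ j₀) ^ (d - 1))⁻¹ * 1 := by rw [mul_one]; exact h1
      _ ≤ (((2 : ℝ) ^ j₀) ^ (d - 1))⁻¹ * (Real.exp 2 * Real.exp (-(s / (2 : ℝ) ^ j₀))) := mul_le_mul_of_nonneg_left h2 h0
      _ = _ := by ring
  refine hterm.trans (mul_le_mul_of_nonneg_left ?_ (Real.exp_pos _).le)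
  exact Finset.single_le_sum (f := fun j => (((2 : ℝ) ^ j) ^ (d - 1))⁻¹ * Real.exp (-(s / (2 : ℝ) ^ j)))
    (fun j _ => by positivity) hj₀J

/-! ## §3 The inverse-power row sum -/

/-- **The inverse-power row-sum constant** `C_d = 2e²(4d)^d` — depends on `d` only. [folklore] -/
def Cps (d : ℕ) : ℝ := 2 * Real.exp 2 * (4 * d) ^ d

omit [∀ i, NeZero (N i)] in
/-- `C_d ≥ 0`. [folklore] -/
theorem Cps_nonneg (d : ℕ) : 0 ≤ Cps d := by unfold Cps; positivity

/-- One dyadic exponential row sum: `((2^j)^{d−1})⁻¹·Σ_{y ∈ S} e^{−dist(x,y)/2^j} ≤ (4d)^d·2^j` (`d ≥ 1`). [folklore] -/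
theorem dyadic_row_le [NeZero d] (x : UT N) (S : Finset (UT N)) (j : ℕ) :
    (((2 : ℝ) ^ j) ^ (d - 1))⁻¹ * ∑ y ∈ S, Real.exp (-(dist x y / (2 : ℝ) ^ j)) ≤ (4 * (d : ℝ)) ^ d * (2 : ℝ) ^ j := by
  have hd1 : 1 ≤ d := Nat.one_le_iff_ne_zero.mpr (NeZero.ne d)
  have h2j : (0 : ℝ) < (2 : ℝ) ^ j := by positivity
  have ha : (0 : ℝ) < ((2 : ℝ) ^ j)⁻¹ := by positivity
  have had : ((2 : ℝ) ^ j)⁻¹ ≤ d := by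
    have h1 : ((2 : ℝ) ^ j)⁻¹ ≤ 1 := inv_le_one_of_one_le₀ (one_le_pow₀ (by norm_num))
    have h2 : (1 : ℝ) ≤ d := by exact_mod_cast hd1
    linarith
  -- the exponential row sum over `S` is at most the full torus sum
  have hrow : ∑ y ∈ S, Real.exp (-(dist x y / (2 : ℝ) ^ j)) ≤ (4 * d / ((2 : ℝ) ^ j)⁻¹) ^ d := by
    calc ∑ y ∈ S, Real.exp (-(dist x y / (2 : ℝ) ^ j))
        ≤ ∑ y : UT N, Real.exp (-(dist x y / (2 : ℝ) ^ j)) :=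
          Finset.sum_le_sum_of_subset_of_nonneg (Finset.subset_univ S) fun _ _ _ => (Real.exp_pos _).le
      _ = ∑ y : UT N, Real.exp (-(((2 : ℝ) ^ j)⁻¹ * dist x y)) :=
          Finset.sum_congr rfl fun y _ => by rw [div_eq_inv_mul]
      _ ≤ B4Sect5Proof.latticeConst d (((2 : ℝ) ^ j)⁻¹) := torusSum_exp_le ha x
      _ ≤ (4 * d / ((2 : ℝ) ^ j)⁻¹) ^ d := latticeConst_le hd1 ha had
  have hsimp : (4 * (d : ℝ) / ((2 : ℝ) ^ j)⁻¹) ^ d = (4 * (d : ℝ)) ^ d * ((2 : ℝ) ^ j) ^ d := by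
    rw [div_inv_eq_mul, mul_pow]
  rw [hsimp] at hrow
  -- `(2^j)^{−(d−1)}·(2^j)^d = 2^j`
  have hpow : (((2 : ℝ) ^ j) ^ (d - 1))⁻¹ * ((2 : ℝ) ^ j) ^ d = (2 : ℝ) ^ j := by
    have e : ((2 : ℝ) ^ j) ^ d = ((2 : ℝ) ^ j) ^ (d - 1) * (2 : ℝ) ^ j := by
      rw [← pow_succ, Nat.sub_add_cancel hd1]
    rw [e, ← mul_assoc, inv_mul_cancel₀ (by positivity), one_mul]
  calc (((2 : ℝ) ^ j) ^ (d - 1))⁻¹ * ∑ y ∈ S, Real.exp (-(dist x y / (2 : ℝ) ^ j))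
      ≤ (((2 : ℝ) ^ j) ^ (d - 1))⁻¹ * ((4 * (d : ℝ)) ^ d * ((2 : ℝ) ^ j) ^ d) := mul_le_mul_of_nonneg_left hrow (by positivity)
    _ = (4 * (d : ℝ)) ^ d * ((((2 : ℝ) ^ j) ^ (d - 1))⁻¹ * ((2 : ℝ) ^ j) ^ d) := by ring
    _ = (4 * (d : ℝ)) ^ d * (2 : ℝ) ^ j := by rw [hpow]

omit [∀ i, NeZero (N i)] in
/-- The geometric sum `Σ_{j < J+1} 2^j ≤ 2·2^J` (reals). [folklore] -/
theorem sum_two_pow_le (J : ℕ) : ∑ j ∈ Finset.range (J + 1), (2 : ℝ) ^ j ≤ 2 * (2 : ℝ) ^ J := by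
  induction J with
  | zero => simp
  | succ n ih =>
    rw [Finset.sum_range_succ, pow_succ]
    linarith

/-- **LEVEL-FREE INVERSE-POWER ROW SUM ON THE TORUS**: for a finite `S` with `dist(x,y) ≤ D` on `S` (`d ≥ 1`),
`Σ_{y ∈ S} ((dist(x,y) + 1)^{d−1})⁻¹ ≤ C_d·(D + 1)`, `C_d = 2e²(4d)^d` — no shell counting: dyadic exponential majorants (§2), the uniform
exponential row sum per dyadic scale (`dyadic_row_le`), and `Σ_{j ≤ log₂(D+1)} 2^j < 2(D+1)`. [folklore] -/
theorem sum_inv_pow_dist_le [NeZero d] (x : UT N) (S : Finset (UT N)) {D : ℕ} (hS : ∀ y ∈ S, dist x y ≤ D) :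
    ∑ y ∈ S, ((dist x y + 1) ^ (d - 1))⁻¹ ≤ Cps d * ((D : ℝ) + 1) := by
  set J := Nat.log 2 (D + 1) with hJ
  -- pointwise dyadic majorant (the torus distance is a natural number)
  have hpt : ∀ y ∈ S, ((dist x y + 1) ^ (d - 1))⁻¹ ≤
      Real.exp 2 * ∑ j ∈ Finset.range (J + 1), (((2 : ℝ) ^ j) ^ (d - 1))⁻¹ * Real.exp (-(dist x y / (2 : ℝ) ^ j)) := by
    intro y hy
    obtain ⟨s, hs⟩ := DeGiorgiStep.dist_natCast x y
    have hsD : s ≤ D := by have h := hS y hy; rw [hs] at h; exact_mod_cast h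
    rw [hs]
    exact inv_pow_le_dyadic d hsD
  have hJD : (2 : ℝ) ^ J ≤ (D : ℝ) + 1 := by
    have h : 2 ^ J ≤ D + 1 := Nat.pow_log_le_self 2 (by omega)
    exact_mod_cast h
  calc ∑ y ∈ S, ((dist x y + 1) ^ (d - 1))⁻¹
      ≤ ∑ y ∈ S, Real.exp 2 * ∑ j ∈ Finset.range (J + 1), (((2 : ℝ) ^ j) ^ (d - 1))⁻¹ * Real.exp (-(dist x y / (2 : ℝ) ^ j)) :=
        Finset.sum_le_sum hpt
    _ = Real.exp 2 * ∑ j ∈ Finset.range (J + 1), (((2 : ℝ) ^ j) ^ (d - 1))⁻¹ * ∑ y ∈ S, Real.exp (-(dist x y / (2 : ℝ) ^ j)) := by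
        rw [← Finset.mul_sum, Finset.sum_comm]
        congr 1
        exact Finset.sum_congr rfl fun j _ => by rw [Finset.mul_sum]
    _ ≤ Real.exp 2 * ∑ j ∈ Finset.range (J + 1), (4 * (d : ℝ)) ^ d * (2 : ℝ) ^ j :=
        mul_le_mul_of_nonneg_left (Finset.sum_le_sum fun j _ => dyadic_row_le x S j) (Real.exp_pos _).le
    _ = Real.exp 2 * (4 * (d : ℝ)) ^ d * ∑ j ∈ Finset.range (J + 1), (2 : ℝ) ^ j := by rw [← Finset.mul_sum]; ring
    _ ≤ Real.exp 2 * (4 * (d : ℝ)) ^ d * (2 * (2 : ℝ) ^ J) :=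
        mul_le_mul_of_nonneg_left (sum_two_pow_le J) (by positivity)
    _ ≤ Real.exp 2 * (4 * (d : ℝ)) ^ d * (2 * ((D : ℝ) + 1)) :=
        mul_le_mul_of_nonneg_left (by linarith) (by positivity)
    _ = Cps d * ((D : ℝ) + 1) := by unfold Cps; ring

end

end Summit.QuantumFields.BalabanUV.Beta.TorusInversePowerSums
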